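import Literature.AlgebraicGeometry.Modules.PullbackPushforwardTwist
import Literature.AlgebraicGeometry.Modules.PushforwardClosedImmersionCoh
import Literature.RingTheory.GaloisAlgebras.ChaseHarrisonRosenbergModules
import HarnessLib

/-!
# `g^* g_* F ≅ ∐_x (τ x)^* F` from Chase–Harrison–Rosenberg charts

Research route conditional on HC_CM; not a corollary; Q11.4-sentence-2 already refuted in dim ≥ 3.
(Context: cell pub-hodge-ring2, director-hodge g13 R13.62 (2) typing debt in support of `stmt-HodgeConjecture-26512`; this
file closes NO item.)  General scheme theory, continuing `PullbackPushforwardTwist.lean`.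

SETTING. `g : X ⟶ Y` affine, a finite group `K` acting on `X` over `Y` by `τ : K → (X ⟶ X)` (`τ x ≫ g = g`, `τ 1 = 𝟙`,
`τ (x y) = τ x ≫ τ y`), `F` an affine-localizing `𝒪_X`-module (e.g. quasi-coherent).  For an affine open `V ⊆ Y` put
`S = Γ(X, g⁻¹V)`, `R = Γ(Y, V)`, `σ_x = (τ x)♯ : S → S` (`twistRingHom`).  The GALOIS-CHART hypotheses at `V` are the
Chase–Harrison–Rosenberg conditions (ii') `∀ x ≠ 1, (σ_x b - b : b ∈ S) · S = S` (`ChartFree`) and `S^K = g♯(R)` (`ChartInvariants`).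

WHAT IS PROVED (sorry-free):
* `toTwist_chartSectionsEquiv_tmul` — on an affine `W ⊆ g⁻¹V`, in the chart coordinates `Γ(g^*g_*F, W) ≃ T ⊗_R N` and
  `Γ((τ x)^*F, W) ≃ T ⊗_{S,σ_x} M` (`chartSectionsEquiv`; `T = Γ(X, W)`, `N = Γ(g_*F, V)`, `M = Γ(F, g⁻¹V)`, `e : N = M` the
  `g♯_V`-semilinear identity `pushforwardRestrictTop`), the `x`-component `(toTwist … x)_W` sends `t ⊗ n ↦ t ⊗ e n`, i.e. the
  tuple `((toTwist … x)_W)_x` IS the module Chase–Harrison–Rosenberg map `galoisProd` (`tupleLin_eq_galoisProd`).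
* `toTwist_tuple_bijective_of_chart` — under the Galois-chart hypotheses at `V` (and `τ 1 = 𝟙`, `τ (x y) = τ x ≫ τ y`),
  `s ↦ ((toTwist … x)_W s)_x` is bijective for every affine `W ⊆ g⁻¹V` (`galoisProd_bijective_of_free`,
  [Greither1992CyclicGalois] Ch. 0 Thm 1.6 (i), Lemma 1.10, applied with `f_x = (τ x)♯_{g⁻¹V → W} = f_1 ∘ σ_x`).
* `isIso_toPi_of_galoisCharts`, `nonempty_pullback_pushforward_iso_sigma_of_galoisCharts` — if every point of `Y` has an
  affine neighbourhood satisfying the Galois-chart hypotheses, `toPi : g^*g_*F ⟶ ∏_x (τ x)^*F` is an isomorphism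
  (`isIso_piLift_of_bijective_on_basis` on the basis of affine `W ⊆ g⁻¹V`, `V` a Galois chart) and `g^*g_*F ≅ ∐_x (τ x)^* F`
  (Mumford's `π^*π_* F ≅ ⊕_x T_x^* F` for the quotient by a free finite group action, [MumfordAV1970] §7 Thm. 4, §12 Thm. 1).
TECHNICAL NOTE. Three elaborations of a pure tensor of `(extendScalars ψ).obj N` occur (Mathlib's anonymous `t ⊗ₜ n`, the
`ChangeOfRings` notation elaborated alone, and the notation elaborated against the module); they agree by `rfl`
(`tmul_eq_notation`, `tmul_notation_eq_expected`) and the proofs rewrite between them explicitly instead of using `erw`.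

References: C. Greither, *Cyclic Galois extensions of commutative rings*, LNM 1534 (1992), Ch. 0 [Greither1992CyclicGalois];
D. Mumford, *Abelian Varieties* (1970), §7, §12 [MumfordAV1970]; R. Hartshorne, GTM 52, II.5 [Hartshorne1977].
-/

noncomputable section

open CategoryTheory CategoryTheory.Limits AlgebraicGeometry TopologicalSpace Opposite TensorProduct
open scoped ChangeOfRings
open Literature.RingTheory.GaloisAlgebras

universe u

namespace Literature.AlgebraicGeometry.Modules

variable {X Y : Scheme.{u}} (g : X ⟶ Y) {K : Type u} (τ : K → (X ⟶ X)) (hτ : ∀ x, τ x ≫ g = g)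

/-- `appLE` along equal morphisms agree (the proof argument is irrelevant). [folklore] -/
private theorem appLE_congr_of_eq {f₁ f₂ : X ⟶ Y} (h : f₁ = f₂) (U : Y.Opens) (W : X.Opens)
    (e₁ : W ≤ f₁ ⁻¹ᵁ U) (e₂ : W ≤ f₂ ⁻¹ᵁ U) : f₁.appLE U W e₁ = f₂.appLE U W e₂ := by
  subst h; rfl

/-! ## §1 The ring automorphisms `σ_x = (τ x)♯` of `Γ(X, g⁻¹V)` and the Galois-chart hypotheses -/

/-- **`σ_x = (τ x)♯ : Γ(X, g⁻¹V) → Γ(X, g⁻¹V)`** — the action of `x ∈ K` on the functions of the stable open `g⁻¹V`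
(`(τ x)⁻¹ g⁻¹V = g⁻¹V`). [cite: MumfordAV1970, §7 Thm. 4 p. 72] -/
def twistRingHom (V : Y.Opens) (x : K) : Γ(X, g ⁻¹ᵁ V) →+* Γ(X, g ⁻¹ᵁ V) :=
  ((τ x).appLE (g ⁻¹ᵁ V) (g ⁻¹ᵁ V) (preimage_preimage_eq g τ hτ x V).ge).hom

/-- **Galois-chart hypothesis (ii')**: for `x ≠ 1` the elements `σ_x(b) - b` generate the unit ideal of `Γ(X, g⁻¹V)`
(Chase–Harrison–Rosenberg's condition (ii'), i.e. freeness of the action on `g⁻¹V`).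
[cite: Greither1992CyclicGalois, Ch. 0 Def. 1.5 and Thm. 1.6 (pp. 3–4)] -/
def ChartFree [Group K] (V : Y.Opens) : Prop :=
  ∀ x : K, x ≠ 1 → Ideal.span (Set.range fun b : Γ(X, g ⁻¹ᵁ V) => twistRingHom g τ hτ V x b - b) = ⊤

/-- **Galois-chart hypothesis `S^K = R`**: a `K`-invariant function on `g⁻¹V` comes from `V`.
[cite: Greither1992CyclicGalois, Ch. 0 Def. 1.5 (p. 3)] -/
def ChartInvariants (V : Y.Opens) : Prop :=
  ∀ b : Γ(X, g ⁻¹ᵁ V), (∀ x : K, twistRingHom g τ hτ V x b = b) → ∃ r : Γ(Y, V), g.app V r = b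

/-! ## §1b Two spellings of a pure tensor -/

/-- Mathlib's anonymous pure tensor `t ⊗ₜ n ∈ (extendScalars ψ).obj N` (left factor typed in
`(restrictScalars ψ).obj (of T T)`, as produced by `TensorProduct.induction_on` and `ExtendScalars.hom_ext`) is the
`ChangeOfRings` pure tensor `t ⊗ₜ[R,ψ] n` of the Chase–Harrison–Rosenberg lemmas. [folklore] -/
private theorem tmul_eq_notation {R T : Type u} [CommRing R] [CommRing T] (ψ : R →+* T) {N : ModuleCat.{u} R}
    (t : T) (n : N) :
    (t ⊗ₜ[R] n : (ModuleCat.extendScalars.{u, u, u} ψ).obj N) = ((t ⊗ₜ[R,ψ] n :) : _) := rfl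

/-- The `ChangeOfRings` pure tensor `t ⊗ₜ[R,ψ] n` elaborated on its own (left factor typed in `T`, as in the
Chase–Harrison–Rosenberg lemmas) is the same pure tensor elaborated against `(extendScalars ψ).obj N` (left factor
typed in `(restrictScalars ψ).obj (of T T)`, as in the chart lemma `chartSectionsEquiv_one_tmul`). [folklore] -/
private theorem tmul_notation_eq_expected {R T : Type u} [CommRing R] [CommRing T] (ψ : R →+* T)
    {N : ModuleCat.{u} R} (t : T) (n : N) :
    ((t ⊗ₜ[R,ψ] n :) : (ModuleCat.extendScalars.{u, u, u} ψ).obj N) =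
      (t ⊗ₜ[R,ψ] n : (ModuleCat.extendScalars.{u, u, u} ψ).obj N) := rfl

/-! ## §2 The chart computation -/

section Chart

variable [IsAffineHom g] (F : X.Modules) {V : Y.Opens} (hV : IsAffineOpen V) {W : X.Opens} (hW : IsAffineOpen W)
  (i : W ≤ g ⁻¹ᵁ V)

include hτ i in
omit [IsAffineHom g] in
/-- `W ⊆ (τ x)⁻¹ g⁻¹V` for `W ⊆ g⁻¹V`. [cite: Hartshorne1977, II.5 (p. 110)] -/
theorem le_twist_preimage (x : K) : W ≤ (τ x) ⁻¹ᵁ (g ⁻¹ᵁ V) := i.trans (preimage_preimage_eq g τ hτ x V).ge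

omit [IsAffineHom g] in
/-- **`Γ(g_*F, V) = Γ(F, g⁻¹V)`** (the identity, as an additive equivalence). [cite: Hartshorne1977, II.5 (p. 109)] -/
def pushforwardSectionsAddEquiv (V : Y.Opens) :
    Γ((Scheme.Modules.pushforward g).obj F, V) ≃+ Γ(F, g ⁻¹ᵁ V) :=
  AddEquiv.refl _

omit [IsAffineHom g] in
/-- The scalars act through `g♯_V`: `r • s ↦ g♯(r) • s`. [cite: Hartshorne1977, II.5 (p. 109)] -/
theorem pushforwardSectionsAddEquiv_smul (V : Y.Opens) (r : Γ(Y, V))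
    (s : Γ((Scheme.Modules.pushforward g).obj F, V)) :
    pushforwardSectionsAddEquiv g F V (r • s) = g.app V r • pushforwardSectionsAddEquiv g F V s :=
  pushforward_smul g F V r s

/-- **The identification `Γ(g_*F, V) = Γ(F, g⁻¹V)` in chart form**: the `g♯_V`-semilinear bijection
`Γ((g_*F)|_{Spec Γ(V)}, ⊤) → Γ(F|_{Spec Γ(g⁻¹V)}, ⊤)`. [cite: Hartshorne1977, II.5 (p. 109)] -/
def pushforwardRestrictTop :
    restrictTop ((Scheme.Modules.pushforward g).obj F) hV →ₛₗ[(g.app V).hom] restrictTop F (hV.preimage g) where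
  toFun n := appTopRestrictFromSpecEquiv F (hV.preimage g)
    (pushforwardSectionsAddEquiv g F V ((appTopRestrictFromSpecEquiv ((Scheme.Modules.pushforward g).obj F) hV).symm n))
  map_add' n n' :=
    (((appTopRestrictFromSpecEquiv ((Scheme.Modules.pushforward g).obj F) hV).symm.toAddEquiv.trans
      (pushforwardSectionsAddEquiv g F V)).trans
        (appTopRestrictFromSpecEquiv F (hV.preimage g)).toAddEquiv).map_add n n'
  map_smul' r n := by
    have h1 : (appTopRestrictFromSpecEquiv ((Scheme.Modules.pushforward g).obj F) hV).symm (r • n) =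
        r • (appTopRestrictFromSpecEquiv ((Scheme.Modules.pushforward g).obj F) hV).symm n :=
      (appTopRestrictFromSpecEquiv ((Scheme.Modules.pushforward g).obj F) hV).symm.map_smul r n
    simp only [h1, pushforwardSectionsAddEquiv_smul, LinearEquiv.map_smul]
    rfl

/-- `pushforwardRestrictTop` is bijective (it is the identity in disguise). [cite: Hartshorne1977, II.5 (p. 109)] -/
theorem pushforwardRestrictTop_bijective : Function.Bijective (pushforwardRestrictTop g F hV) :=
  (appTopRestrictFromSpecEquiv F (hV.preimage g)).bijective.comp
    (appTopRestrictFromSpecEquiv ((Scheme.Modules.pushforward g).obj F) hV).symm.bijective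

/-- `pushforwardRestrictTop` on a section `m ∈ Γ(g_*F, V)`: the same section `m ∈ Γ(F, g⁻¹V)`.
[cite: Hartshorne1977, II.5 (p. 109)] -/
theorem pushforwardRestrictTop_apply (m : Γ((Scheme.Modules.pushforward g).obj F, V)) :
    pushforwardRestrictTop g F hV (appTopRestrictFromSpecEquiv ((Scheme.Modules.pushforward g).obj F) hV m) =
      appTopRestrictFromSpecEquiv F (hV.preimage g) (pushforwardSectionsAddEquiv g F V m) := by
  simp only [pushforwardRestrictTop, LinearMap.coe_mk, AddHom.coe_mk, LinearEquiv.symm_apply_apply]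

omit [IsAffineHom g] in
/-- `(τ x)♯_{g⁻¹V → W} ∘ g♯_V = g♯_{V → W}`. [cite: Hartshorne1977, II.5 (p. 110)] -/
theorem chartHom_twist_comp_app (x : K) (r : Γ(Y, V)) :
    (chartHom (τ x) (le_twist_preimage g τ hτ i x)).hom ((g.app V).hom r) = (chartHom g i).hom r := by
  change (g.app V ≫ (τ x).appLE (g ⁻¹ᵁ V) W (le_twist_preimage g τ hτ i x)) r = _
  rw [← Scheme.Hom.comp_appLE (τ x) g V W (le_twist_preimage g τ hτ i x)]
  rw [appLE_congr_of_eq (hτ x) V W _ i]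

/-- The tuple `z ↦ (c_x⁻¹ ((toTwist … x)_W (c_G z)))_x` in chart coordinates, as a `Γ(W)`-linear map
`T ⊗_R N → ∏_x T ⊗_{S,σ_x} M` (plumbing for `tupleLin_eq_galoisProd`). [folklore] -/
private def tupleLin (hF : IsAffineLocalizing F) :
    chartTensor g ((Scheme.Modules.pushforward g).obj F) hV i →ₗ[Γ(X, W)]
      ∀ x : K, chartTensor (τ x) F (hV.preimage g) (le_twist_preimage g τ hτ i x) where
  toFun z x :=
    (chartSectionsEquiv (τ x) F (hV.preimage g) hW (le_twist_preimage g τ hτ i x) hF).symm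
      ((toTwist g τ hτ F x).app W
        (chartSectionsEquiv g ((Scheme.Modules.pushforward g).obj F) hV hW i
          (isAffineLocalizing_pushforward_of_isAffineHom g hF) z))
  map_add' z z' := funext fun x => by
    simp only [map_add, Pi.add_apply]
  map_smul' c z := funext fun x => by
    simp only [Pi.smul_apply, RingHom.id_apply, chartSectionsEquiv_smul, Scheme.Modules.Hom.app_smul]
    rw [AddEquiv.symm_apply_eq, chartSectionsEquiv_smul, AddEquiv.apply_symm_apply]

/-- `tupleLin` evaluated (definitional unfolding). [folklore] -/
private theorem tupleLin_apply (hF : IsAffineLocalizing F)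
    (z : chartTensor g ((Scheme.Modules.pushforward g).obj F) hV i) (x : K) :
    tupleLin g τ hτ F hV hW i hF z x =
      (chartSectionsEquiv (τ x) F (hV.preimage g) hW (le_twist_preimage g τ hτ i x) hF).symm
        ((toTwist g τ hτ F x).app W
          (chartSectionsEquiv g ((Scheme.Modules.pushforward g).obj F) hV hW i
            (isAffineLocalizing_pushforward_of_isAffineHom g hF) z)) := rfl

/-- **The chart identity**: in chart coordinates the tuple `((toTwist … x)_W)_x` IS the module
Chase–Harrison–Rosenberg map `galoisProd` (`t ⊗ n ↦ (t ⊗ e n)_x`) for the `g♯_V`-semilinear identification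
`e : Γ(g_*F, V) = Γ(F, g⁻¹V)` (`pushforwardRestrictTop`). [cite: Greither1992CyclicGalois, Ch. 0 Remark before Lemma 1.10 (p. 5)] -/
private theorem tupleLin_eq_galoisProd (hF : IsAffineLocalizing F) :
    tupleLin g τ hτ F hV hW i hF =
      galoisProd (chartHom g i).hom (g.app V).hom (fun x => (chartHom (τ x) (le_twist_preimage g τ hτ i x)).hom)
        (chartHom_twist_comp_app g τ hτ i) (pushforwardRestrictTop g F hV) := by
  have h : ModuleCat.ofHom (tupleLin g τ hτ F hV hW i hF) =
      ModuleCat.ofHom (galoisProd (chartHom g i).hom (g.app V).hom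
        (fun x => (chartHom (τ x) (le_twist_preimage g τ hτ i x)).hom)
        (chartHom_twist_comp_app g τ hτ i) (pushforwardRestrictTop g F hV)) := by
    apply ModuleCat.ExtendScalars.hom_ext
    intro n
    obtain ⟨m, rfl⟩ :=
      (appTopRestrictFromSpecEquiv ((Scheme.Modules.pushforward g).obj F) hV).surjective n
    funext x
    change tupleLin g τ hτ F hV hW i hF _ x =
      galoisProd (chartHom g i).hom (g.app V).hom (fun x => (chartHom (τ x) (le_twist_preimage g τ hτ i x)).hom)
        (chartHom_twist_comp_app g τ hτ i) (pushforwardRestrictTop g F hV) _ x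
    rw [tmul_eq_notation (chartHom g i).hom (N := restrictTop ((Scheme.Modules.pushforward g).obj F) hV) 1
        (appTopRestrictFromSpecEquiv ((Scheme.Modules.pushforward g).obj F) hV m),
      tupleLin_apply, galoisProd_tmul, AddEquiv.symm_apply_eq]
    rw [tmul_notation_eq_expected (chartHom g i).hom
        (N := restrictTop ((Scheme.Modules.pushforward g).obj F) hV) 1
        (appTopRestrictFromSpecEquiv ((Scheme.Modules.pushforward g).obj F) hV m),
      chartSectionsEquiv_one_tmul, toTwist_app_unitSectionLE, pushforwardRestrictTop_apply,
      tmul_notation_eq_expected (chartHom (τ x) (le_twist_preimage g τ hτ i x)).hom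
        (N := restrictTop F (hV.preimage g)) 1
        (appTopRestrictFromSpecEquiv F (hV.preimage g) (pushforwardSectionsAddEquiv g F V m)),
      chartSectionsEquiv_one_tmul]
    rfl
  exact congrArg ModuleCat.Hom.hom h

/-- **The chart identity on pure tensors**: `(toTwist … x)_W (c_G (t ⊗ m)) = c_x (t ⊗ m)` for `t ∈ Γ(X, W)` and
`m ∈ Γ(g_*F, V) = Γ(F, g⁻¹V)`. [cite: Greither1992CyclicGalois, Ch. 0 Remark before Lemma 1.10 (p. 5)] -/
theorem toTwist_chartSectionsEquiv_tmul (hF : IsAffineLocalizing F) (x : K) (t : Γ(X, W))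
    (n : restrictTop ((Scheme.Modules.pushforward g).obj F) hV) :
    (toTwist g τ hτ F x).app W
        (chartSectionsEquiv g ((Scheme.Modules.pushforward g).obj F) hV hW i
          (isAffineLocalizing_pushforward_of_isAffineHom g hF) ((t ⊗ₜ[Γ(Y, V), (chartHom g i).hom] n :) : _)) =
      chartSectionsEquiv (τ x) F (hV.preimage g) hW (le_twist_preimage g τ hτ i x) hF
        ((t ⊗ₜ[Γ(X, g ⁻¹ᵁ V), (chartHom (τ x) (le_twist_preimage g τ hτ i x)).hom]
          pushforwardRestrictTop g F hV n :) : _) := by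
  have h := congrFun (LinearMap.congr_fun (tupleLin_eq_galoisProd g τ hτ F hV hW i hF)
    ((t ⊗ₜ[Γ(Y, V), (chartHom g i).hom] n :) : _)) x
  rw [tupleLin_apply, galoisProd_tmul, AddEquiv.symm_apply_eq] at h
  exact h

include hV hW i in
/-- **Bijectivity on a Galois chart**: under `ChartFree` and `ChartInvariants` at `V` (and `τ` a group action over `Y`),
the tuple `s ↦ ((toTwist … x)_W s)_x : Γ(g^*g_*F, W) → ∏_x Γ((τ x)^*F, W)` is bijective for every affine `W ⊆ g⁻¹V`.
[cite: Greither1992CyclicGalois, Ch. 0 Thm. 1.6 (i) (pp. 3–4) and Lemma 1.10 (p. 5)] -/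
theorem toTwist_tuple_bijective_of_chart [Group K] [Fintype K] (hτone : τ 1 = 𝟙 X)
    (hτmul : ∀ x y, τ (x * y) = τ x ≫ τ y) (hF : IsAffineLocalizing F)
    (hfree : ChartFree g τ hτ V) (hinv : ChartInvariants g τ hτ V) :
    Function.Bijective (fun s : Γ((Scheme.Modules.pullback g).obj ((Scheme.Modules.pushforward g).obj F), W) =>
      fun x : K => (toTwist g τ hτ F x).app W s) := by
  -- the `K`-action on `S = Γ(X, g⁻¹V)` by `σ_x = (τ x)♯`
  have hσ1 : ∀ b : Γ(X, g ⁻¹ᵁ V), twistRingHom g τ hτ V 1 b = b := fun b => by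
    change ((τ 1).appLE (g ⁻¹ᵁ V) (g ⁻¹ᵁ V) _) b = b
    rw [appLE_congr_of_eq hτone (g ⁻¹ᵁ V) (g ⁻¹ᵁ V) _ le_rfl]
    erw [Scheme.Hom.appLE_eq_app, Scheme.Hom.id_app]
    rfl
  have hσmul : ∀ (x y : K) (b : Γ(X, g ⁻¹ᵁ V)),
      twistRingHom g τ hτ V (x * y) b = twistRingHom g τ hτ V x (twistRingHom g τ hτ V y b) := fun x y b => by
    change ((τ (x * y)).appLE _ _ _) b =
      ((τ y).appLE (g ⁻¹ᵁ V) (g ⁻¹ᵁ V) _ ≫ (τ x).appLE (g ⁻¹ᵁ V) (g ⁻¹ᵁ V) _) b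
    rw [Scheme.Hom.appLE_comp_appLE, appLE_congr_of_eq (hτmul x y) (g ⁻¹ᵁ V) (g ⁻¹ᵁ V)]
  letI : MulSemiringAction K Γ(X, g ⁻¹ᵁ V) :=
    { smul := fun x b => twistRingHom g τ hτ V x b
      one_smul := hσ1
      mul_smul := hσmul
      smul_zero := fun x => map_zero (twistRingHom g τ hτ V x)
      smul_add := fun x => map_add (twistRingHom g τ hτ V x)
      smul_one := fun x => map_one (twistRingHom g τ hτ V x)
      smul_mul := fun x => map_mul (twistRingHom g τ hτ V x) }
  -- `f_x = f_1 ∘ σ_x`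
  have hf : ∀ (x : K) (b : Γ(X, g ⁻¹ᵁ V)),
      (chartHom (τ x) (le_twist_preimage g τ hτ i x)).hom b =
        (chartHom (τ 1) (le_twist_preimage g τ hτ i 1)).hom (x • b) := fun x b => by
    change ((τ x).appLE (g ⁻¹ᵁ V) W _) b =
      ((τ x).appLE (g ⁻¹ᵁ V) (g ⁻¹ᵁ V) _ ≫ (τ 1).appLE (g ⁻¹ᵁ V) W _) b
    rw [Scheme.Hom.appLE_comp_appLE,
      appLE_congr_of_eq (show τ 1 ≫ τ x = τ x by rw [← hτmul, one_mul]) (g ⁻¹ᵁ V) W _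
        (le_twist_preimage g τ hτ i x)]
  have hfree' : ∀ x : K, x ≠ 1 → Ideal.span (Set.range fun b : Γ(X, g ⁻¹ᵁ V) => x • b - b) = ⊤ :=
    fun x hx => hfree x hx
  have hinv' : ∀ b : Γ(X, g ⁻¹ᵁ V), (∀ x : K, x • b = b) → ∃ r : Γ(Y, V), (g.app V).hom r = b :=
    fun b hb => hinv b hb
  -- the module Chase–Harrison–Rosenberg theorem, transported to the tuple by the chart identity
  have hΦ := galoisProd_bijective_of_free (chartHom g i).hom (g.app V).hom
    (fun x => (chartHom (τ x) (le_twist_preimage g τ hτ i x)).hom) (chartHom_twist_comp_app g τ hτ i)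
    (pushforwardRestrictTop g F hV) hfree' hf hinv' (pushforwardRestrictTop_bijective g F hV)
  rw [← tupleLin_eq_galoisProd g τ hτ F hV hW i hF] at hΦ
  have hfac : (fun s : Γ((Scheme.Modules.pullback g).obj ((Scheme.Modules.pushforward g).obj F), W) =>
      fun x : K => (toTwist g τ hτ F x).app W s) =
      ((AddEquiv.piCongrRight fun x : K =>
          chartSectionsEquiv (τ x) F (hV.preimage g) hW (le_twist_preimage g τ hτ i x) hF) ∘
        tupleLin g τ hτ F hV hW i hF) ∘
        (chartSectionsEquiv g ((Scheme.Modules.pushforward g).obj F) hV hW i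
          (isAffineLocalizing_pushforward_of_isAffineHom g hF)).symm := by
    funext s
    funext x
    simp only [Function.comp_apply, AddEquiv.piCongrRight_apply, tupleLin_apply, AddEquiv.apply_symm_apply]
  rw [hfac]
  exact ((AddEquiv.bijective _).comp hΦ).comp (AddEquiv.bijective _)

end Chart

/-! ## §3 Gluing: `toPi` is an isomorphism when `Y` is covered by Galois charts -/

/-- **`toPi : g^*g_*F ⟶ ∏_x (τ x)^*F` is an isomorphism** when `g` is affine, `τ` is a `K`-action over `Y` and every point
of `Y` has an affine neighbourhood satisfying the Galois-chart hypotheses (`ChartFree`, `ChartInvariants`), for `F`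
affine-localizing. [cite: MumfordAV1970, §7 Thm. 4 p. 72] -/
theorem isIso_toPi_of_galoisCharts [IsAffineHom g] [Group K] [Fintype K] (hτone : τ 1 = 𝟙 X)
    (hτmul : ∀ x y, τ (x * y) = τ x ≫ τ y) (F : X.Modules) (hF : IsAffineLocalizing F)
    (hcharts : ∀ y : Y, ∃ V : Y.Opens, y ∈ V ∧ IsAffineOpen V ∧ ChartFree g τ hτ V ∧ ChartInvariants g τ hτ V) :
    IsIso (toPi g τ hτ F) := by
  refine isIso_piLift_of_bijective_on_basis (fun x : K => (Scheme.Modules.pullback (τ x)).obj F) (toTwist g τ hτ F)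
    (B := {W : X.Opens | IsAffineOpen W ∧ ∃ V : Y.Opens, IsAffineOpen V ∧ ChartFree g τ hτ V ∧
      ChartInvariants g τ hτ V ∧ W ≤ g ⁻¹ᵁ V}) ?_ ?_
  · rw [Opens.isBasis_iff_nbhd]
    intro U p hp
    obtain ⟨V, hpV, hV, hfr, hin⟩ := hcharts (g.base p)
    obtain ⟨W, hW, hpW, hWle⟩ := (Opens.isBasis_iff_nbhd.mp X.isBasis_affineOpens)
      (show p ∈ U ⊓ g ⁻¹ᵁ V from ⟨hp, hpV⟩)
    exact ⟨W, ⟨hW, V, hV, hfr, hin, hWle.trans inf_le_right⟩, hpW, hWle.trans inf_le_left⟩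
  · rintro W ⟨hW, V, hV, hfr, hin, hi⟩
    exact toTwist_tuple_bijective_of_chart g τ hτ F hV hW hi hτone hτmul hF hfr hin

/-- **`g^* g_* F ≅ ∐_{x ∈ K} (τ x)^* F`** under the hypotheses of `isIso_toPi_of_galoisCharts` — Mumford's
`π^*π_*F ≅ ⊕_x T_x^*F` for the quotient `π` by a free action of a finite group. [cite: MumfordAV1970, §7 Thm. 4 p. 72] -/
theorem nonempty_pullback_pushforward_iso_sigma_of_galoisCharts [IsAffineHom g] [Group K]
    [Fintype K] (hτone : τ 1 = 𝟙 X)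
    (hτmul : ∀ x y, τ (x * y) = τ x ≫ τ y) (F : X.Modules) (hF : IsAffineLocalizing F)
    (hcharts : ∀ y : Y, ∃ V : Y.Opens, y ∈ V ∧ IsAffineOpen V ∧ ChartFree g τ hτ V ∧ ChartInvariants g τ hτ V) :
    Nonempty ((Scheme.Modules.pullback g).obj ((Scheme.Modules.pushforward g).obj F) ≅
      ∐ fun x : K => (Scheme.Modules.pullback (τ x)).obj F) :=
  nonempty_iso_sigmaObj_of_isIso_toPi g τ hτ F (isIso_toPi_of_galoisCharts g τ hτ hτone hτmul F hF hcharts)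

end Literature.AlgebraicGeometry.Modules
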